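import Mathlib
import HarnessLib
import Summits.HubbardSuperconductivity.HubbardSuperconductivity.Theorems.KLProgrammeC4aPPKernelNegPreThermal
import Summits.HubbardSuperconductivity.HubbardSuperconductivity.Theorems.KLProgrammeC4aPreCausticLevelLineDiagonal

/-!
# Route `KLProgramme` — crux C4a, S3 brick (B4) «(B4)-UMK1», «(M1)-NEG-PRE-KERNEL»: the DIAGONAL MAJORANT of the TRUE mixed-sign pp pair kernel
# (negative loop levels on the pre side) — the four kernel rows of `…C4aPreCausticLevelLineDiagonal.abs_intervalIntegral_levelLine_diagonal_le`
# discharged for `K s u := ppTrueKernel β Λ (−s) u`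

Cell `gate-hubbard-kl`, seat hubbard-kl-k3c3-p1 (g16; row «δμ-flow with klAngularMean constant piece»).  Located brick for the (U1) chain of hubbard-kl-k3c3-p3
(g32, «(U1)-NEG-PRE», U1-CAUSTIC-SUP.md §12) / the (C)-closer lane (stub (C) `stub_twoLeg_curvature` of `KLRegimeEngineV17F2`, stmt-HubbardSuperconductivity-20437);
part 2 of 2 (part 1 = `…C4aPPKernelNegPreThermal`: parity, far closed forms, thermal sizes); memo HOME/hubbard-kl-k3c3-p1/g16-M1-NEG-PRE-KERNEL.md.

WHY.  On the PRE side of a caustic window the partner line of a loop level BELOW the Fermi level, `e = −s` (`s ∈ [lo,hi]`), is the DIAGONAL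
`u = ē(−s,·) ≈ D + s` (rate window `|u − s − D| ≤ s/2`, so `u ≥ s/2`), and the kernel there is the mixed-sign pair kernel `u ↦ P(−s,u)` (the product form
`ppTrueKernel` of `…C4aPPKernelTrueProductForm`, all fermionic frequencies, above-scale Salmhofer weights at scale `Λ`).  k3c3-p3's level-line lemma
`abs_intervalIntegral_levelLine_diagonal_le` asks of it exactly four rows: a DIAGONAL MAJORANT `|(K s)′ u| ≤ ρ(s)/max(u − s, lo)²` (`u ≥ s/2`), `ρ ≥ 0`,
`ρ` interval-integrable, and the TAIL LAW `∫_a^hi ρ ≤ Mρ·lo·(lo/a)²`.  This file discharges them with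
  `ρ(s) = 64·C½·Λ³/(s + 2Λ)³ + ((β·lo)² + 2)·e^{−βs/2}`,  `Mρ = 32·C½·(Λ/lo)³ + 32·((β·lo)² + 2)/(β·lo)³`,  `C½ = 64B₂ + 120B₁ + 154`
(`B₁ = sup|χ′|`, `B₂ = sup|χ″|` of the Salmhofer cutoff; with `lo = Λ` and `βΛ ≥ 1`, `Mρ ≤ 32C½ + 96` — `T`-, `Λ`- and `n`-free).  Two regimes, no absolute value
per frequency anywhere:
* `s ≤ 2Λ`: the REFLECTED SIGNED ENVELOPE of part 1 §1 — `|∂ᵤP(−s,u)| ≤ C½/max(s,u)² ≤ C½/max(u − s, lo)²` (because `lo ≤ s` and `u − s ≤ u`), and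
  `C½ ≤ 64C½Λ³/(s+2Λ)³` there;
* `s > 2Λ` (§4b): then `u ≥ s/2 > Λ`, both lines are FAR (`W ≡ 1`), `P(−s,u) = [tanh(βu/2) − tanh(βs/2)]/(2(u − s))` EXACTLY, and part 1 §4 gives
  `|∂ᵤP(−s,u)| ≤ β²·e^{−βs/2}` near the diagonal (`u − s ≤ lo`: `= (β·lo)²e^{−βs/2}/lo²`) and `≤ 2e^{−βs}/(u − s)²` beyond it — the thermal (Pauli-blocking)
  smallness of the mixed-sign bubble, a CANCELLATION ACROSS FREQUENCIES visible only in the closed form; the single point `u = s` by continuity.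
* §5 the rows: **`abs_ppTrueKernelDu_negLevel_le_majorant`** / **`abs_deriv_ppTrueKernel_negLevel_le_majorant`** (`hK1`), `negPreMajorant_nonneg` (`hρ0`),
  `intervalIntegrable_negPreMajorant` (`hρi`), `continuousOn_negPreMajorant` (`hρc` of `…C4aFoldBoxPreLawBelow`), **`intervalIntegral_negPreMajorant_tail_le`**
  (`hρtail`: the power piece by the primitive `−32C½Λ³/(s+2Λ)²`, the thermal piece by k3c3-p3's `intervalIntegral_exp_tail_le` with `κ = β/2`), the JOINT
  CONTINUITY `continuous_ppTrueKernelDu_comp` / **`continuous_deriv_ppTrueKernel_negLevel₂`** (`hKc` of `…C4aFoldBoxPreLawBelow`: `(s,u) ↦ ∂ᵤP(−s,u)` continuous on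
  `ℝ × ℝ`, a uniformly dominated series), and the ONE-CALL composition
  **`abs_intervalIntegral_levelLine_diagonal_ppTrueKernel_le`**: the pre-caustic level line along the diagonal for the TRUE kernel,
  `|∫_{lo..hi} w·X·(K s)′(ē s)| ≤ 5·(W·X₀·Mρ)·lo/max(D,lo)²` with the `Mρ` above.
Also recorded for a split factor's `κ′`-term (§4b): the VALUE sizes `|P(−s,u)| ≤ β·e^{−βs/2}` (`2Λ < s`, `u ≥ s/2`) and `|P(−s,u)| ≤ e^{−βs}/(u − s)` (`Λ < s < u`);
the reflected value envelope `|P(−s,u)| ≤ (12B₁+9)/max(s,|u|)` (all `s > 0`, all `u`) is part 1's `abs_ppTrueKernel_negLevel_le_inv_max`.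
Pure real analysis on Literature objects; nothing asserts (C), K3, the window or superconductivity.
References: BGM 2006 §2.1 (2.2)–(2.5), §2.4 (2.36) [cite: BenfattoGiulianiMastropietro2006]; Salmhofer 1999 §4.2.5 (4.70)–(4.71), §4.5.3 [cite: Salmhofer1999];
FST II CPAM 51 (1998) §3 [cite: FeldmanSalmhoferTrubowitz1998].
-/

noncomputable section

namespace Summit.HubbardSuperconductivity.HubbardSuperconductivity.Theorems.C4a

set_option linter.dupNamespace false -- summit = problem name (single-conjunct summit), D-0017

open Real Filter Set MeasureTheory intervalIntegral
open scoped Topology Interval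
open Literature.MathematicalPhysics.QuantumLattice Literature.Analysis.SpecialFunctions

/-! ## §4b The thermal sizes transported to the true kernel (loop level beyond twice the scale ⟹ both lines far) -/

/-- **The mixed-sign kernel's derivative near the diagonal, loop level beyond twice the scale**: `2Λ < s`, `s/2 ≤ u` ⟹ `|∂ᵤP(−s,u)| ≤ β²·e^{−βs/2}`
(both lines far; the single point `u = s` by continuity). [cite: BenfattoGiulianiMastropietro2006, §2.4 (2.36)] -/
theorem abs_ppTrueKernelDu_negLevel_thermal_le {β Λ : ℝ} (hβ : 0 < β) (hΛ : 0 < Λ) {B₁ : ℝ} (hB₁ : ∀ x, |deriv salmhoferCutoff x| ≤ B₁) {s u : ℝ}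
    (hs : 2 * Λ < s) (hu : s / 2 ≤ u) : |ppTrueKernelDu β Λ (-s) u| ≤ β ^ 2 * Real.exp (-(β / 2 * s)) := by
  have hs0 : 0 < s := by linarith
  have hsfar : Λ < s := by linarith
  have hoff : ∀ v, s / 2 ≤ v → v ≠ s → |ppTrueKernelDu β Λ (-s) v| ≤ β ^ 2 * Real.exp (-(β / 2 * s)) := fun v hv hne => by
    have hvfar : Λ < v := by linarith
    rw [ppTrueKernelDu_negLevel_far_eq hβ hΛ hB₁ hsfar hvfar hne]
    exact abs_thermalDiagonal_deriv_le hβ hs0 hv hne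
  rcases ne_or_eq u s with hne | hne
  · exact hoff u hu hne
  · rw [hne]
    have hf : Continuous fun v : ℝ => |ppTrueKernelDu β Λ (-s) v| := (continuous_ppTrueKernelDu_u hβ hΛ hB₁ (-s)).abs
    have hev : ∀ᶠ v in 𝓝[≠] s, |ppTrueKernelDu β Λ (-s) v| ≤ β ^ 2 * Real.exp (-(β / 2 * s)) := by
      have ho : IsOpen {v : ℝ | s / 2 < v} := isOpen_lt continuous_const continuous_id
      have hmem : {v : ℝ | s / 2 < v} ∈ 𝓝[≠] s := mem_nhdsWithin_of_mem_nhds (ho.mem_nhds (by show s / 2 < s; linarith))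
      filter_upwards [hmem, self_mem_nhdsWithin] with v hv hv'
      exact hoff v (le_of_lt hv) hv'
    exact le_of_tendsto (hf.continuousAt.tendsto.mono_left nhdsWithin_le_nhds) hev

/-- **The mixed-sign kernel's derivative beyond the diagonal, both lines far**: `Λ < s < u` ⟹ `|∂ᵤP(−s,u)| ≤ 2e^{−βs}·(u − s)⁻¹²`.
[cite: BenfattoGiulianiMastropietro2006, §2.4 (2.36)] -/
theorem abs_ppTrueKernelDu_negLevel_thermal_far_le {β Λ : ℝ} (hβ : 0 < β) (hΛ : 0 < Λ) {B₁ : ℝ} (hB₁ : ∀ x, |deriv salmhoferCutoff x| ≤ B₁) {s u : ℝ}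
    (hs : Λ < s) (hsu : s < u) : |ppTrueKernelDu β Λ (-s) u| ≤ 2 * Real.exp (-(β * s)) * ((u - s)⁻¹ ^ 2) := by
  rw [ppTrueKernelDu_negLevel_far_eq hβ hΛ hB₁ hs (hs.trans hsu) (ne_of_gt hsu)]
  exact abs_thermalDiagonal_deriv_far_le hβ (hΛ.trans hs) hsu

/-- **The mixed-sign kernel's VALUE near the diagonal, loop level beyond twice the scale**: `2Λ < s`, `s/2 ≤ u` ⟹ `|P(−s,u)| ≤ β·e^{−βs/2}`
(`P(−s,u) = ½f′(η)`, `η ≥ min(s,u) ≥ s/2`; for a split factor's `κ′`-term). [cite: BenfattoGiulianiMastropietro2006, §2.4 (2.36)] -/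
theorem abs_ppTrueKernel_negLevel_thermal_le {β Λ : ℝ} (hβ : 0 < β) (hΛ : 0 < Λ) {s u : ℝ}
    (hs : 2 * Λ < s) (hu : s / 2 ≤ u) : |ppTrueKernel β Λ (-s) u| ≤ β * Real.exp (-(β / 2 * s)) := by
  have hs0 : 0 < s := by linarith
  have hsfar : Λ < s := by linarith
  have hd1 : ∀ y, HasDerivAt (fun y : ℝ => Real.tanh (β * y / 2)) (β / 2 * sech (β * y / 2) ^ 2) y := fun y => hasDerivAt_tanh_scaled β y
  have hoff : ∀ v, s / 2 ≤ v → v ≠ s → |ppTrueKernel β Λ (-s) v| ≤ β * Real.exp (-(β / 2 * s)) := fun v hv hne => by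
    have hvfar : Λ < |v| := by rw [abs_of_pos (by linarith)]; linarith
    rw [ppTrueKernel_negLevel_far_eq hβ hΛ hsfar hvfar hne]
    obtain ⟨η, hη1, _hη2, hη⟩ := exists_between_hasDerivAt_eq_slope hd1 hne.symm
    have hvs : v - s ≠ 0 := sub_ne_zero.2 hne
    rw [hη, show 1 / 2 * (β / 2 * sech (β * η / 2) ^ 2 * (v - s)) / (v - s) = β / 4 * sech (β * η / 2) ^ 2 by field_simp; ring]
    have hη0 : s / 2 ≤ η := by
      have hmin : s / 2 ≤ min s v := le_min (by linarith) hv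
      linarith
    have hsech : sech (β * η / 2) ^ 2 ≤ 4 * Real.exp (-(2 * |β * η / 2|)) := sech_sq_le_four_exp_neg _
    have habs : 2 * |β * η / 2| = β * η := by rw [abs_of_nonneg (by nlinarith [hη0, hs0, hβ])]; ring
    rw [habs] at hsech
    have hexp : Real.exp (-(β * η)) ≤ Real.exp (-(β / 2 * s)) := Real.exp_le_exp.2 (by nlinarith)
    rw [abs_of_nonneg (by positivity)]
    calc β / 4 * sech (β * η / 2) ^ 2 ≤ β / 4 * (4 * Real.exp (-(β / 2 * s))) := by gcongr; exact hsech.trans (by linarith)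
      _ = β * Real.exp (-(β / 2 * s)) := by ring
  rcases ne_or_eq u s with hne | hne
  · exact hoff u hu hne
  · rw [hne]
    have hf : Continuous fun v : ℝ => |ppTrueKernel β Λ (-s) v| := (continuous_ppTrueKernel_u hβ Λ (-s)).abs
    have hev : ∀ᶠ v in 𝓝[≠] s, |ppTrueKernel β Λ (-s) v| ≤ β * Real.exp (-(β / 2 * s)) := by
      have ho : IsOpen {v : ℝ | s / 2 < v} := isOpen_lt continuous_const continuous_id
      have hmem : {v : ℝ | s / 2 < v} ∈ 𝓝[≠] s := mem_nhdsWithin_of_mem_nhds (ho.mem_nhds (by show s / 2 < s; linarith))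
      filter_upwards [hmem, self_mem_nhdsWithin] with v hv hv'
      exact hoff v (le_of_lt hv) hv'
    exact le_of_tendsto (hf.continuousAt.tendsto.mono_left nhdsWithin_le_nhds) hev

/-- **The mixed-sign kernel's VALUE beyond the diagonal, both lines far**: `Λ < s < u` ⟹ `|P(−s,u)| ≤ e^{−βs}·(u − s)⁻¹`
(`0 ≤ tanh(βu/2) − tanh(βs/2) ≤ 1 − tanh(βs/2) ≤ 2e^{−βs}`). [cite: BenfattoGiulianiMastropietro2006, §2.4 (2.36)] -/
theorem abs_ppTrueKernel_negLevel_thermal_far_le {β Λ : ℝ} (hβ : 0 < β) (hΛ : 0 < Λ) {s u : ℝ} (hs : Λ < s) (hsu : s < u) :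
    |ppTrueKernel β Λ (-s) u| ≤ Real.exp (-(β * s)) * (u - s)⁻¹ := by
  have hs0 : 0 < s := hΛ.trans hs
  have hd : 0 < u - s := sub_pos.2 hsu
  have hufar : Λ < |u| := by rw [abs_of_pos (hs0.trans hsu)]; exact hs.trans hsu
  rw [ppTrueKernel_negLevel_far_eq hβ hΛ hs hufar (ne_of_gt hsu)]
  have hmono : Real.tanh (β * s / 2) ≤ Real.tanh (β * u / 2) := by
    have hx : Real.tanh (β * s / 2) ∈ Set.Ioo (-1 : ℝ) 1 := ⟨Real.neg_one_lt_tanh _, Real.tanh_lt_one _⟩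
    have hy : Real.tanh (β * u / 2) ∈ Set.Ioo (-1 : ℝ) 1 := ⟨Real.neg_one_lt_tanh _, Real.tanh_lt_one _⟩
    exact (Real.artanh_le_artanh_iff hx hy).1 (by rw [Real.artanh_tanh, Real.artanh_tanh]; nlinarith)
  have hlt1 : Real.tanh (β * u / 2) < 1 := Real.tanh_lt_one _
  have hgap : 1 - Real.tanh (β * s / 2) ≤ 2 * Real.exp (-(β * s)) := by
    have h := one_sub_tanh_le_two_exp_neg (β * s / 2)
    rwa [show 2 * (β * s / 2) = β * s by ring] at h
  rw [abs_of_nonneg (div_nonneg (mul_nonneg (by norm_num) (by linarith)) hd.le)]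
  calc 1 / 2 * (Real.tanh (β * u / 2) - Real.tanh (β * s / 2)) / (u - s) ≤ 1 / 2 * (2 * Real.exp (-(β * s))) / (u - s) := by
        gcongr; linarith
    _ = Real.exp (-(β * s)) * (u - s)⁻¹ := by field_simp

/-! ## §5 The four kernel rows of `abs_intervalIntegral_levelLine_diagonal_le` for the true kernel, and the one-call composition -/

/-- `B₂ ≥ 0` from the second-derivative bound of the cutoff. [folklore] -/
theorem salmhoferB₂_nonneg {B₂ : ℝ} (hB₂ : ∀ x, |deriv (deriv salmhoferCutoff) x| ≤ B₂) : 0 ≤ B₂ := (abs_nonneg _).trans (hB₂ 0)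

/-- **ROW `hK1` — THE DIAGONAL MAJORANT OF THE TRUE MIXED-SIGN KERNEL.**  `0 < β`, `0 < Λ`, `|χ′| ≤ B₁`, `|χ″| ≤ B₂`, `0 < lo ≤ s`, `s/2 ≤ u` ⟹
`|∂ᵤP(−s,u)| ≤ ρ(s)·max(u − s, lo)⁻¹²` with `ρ(s) = 64·C½·Λ³/(s+2Λ)³ + ((β·lo)²+2)·e^{−βs/2}`, `C½ = 64B₂+120B₁+154`
(regime `s ≤ 2Λ`: reflected envelope, `max(u−s,lo) ≤ max(s,u)`; regime `s > 2Λ`: the thermal sizes of §4).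
[cite: BenfattoGiulianiMastropietro2006, §2.4 (2.36)] -/
theorem abs_ppTrueKernelDu_negLevel_le_majorant {β Λ : ℝ} (hβ : 0 < β) (hΛ : 0 < Λ) {B₁ B₂ : ℝ} (hB₁ : ∀ x, |deriv salmhoferCutoff x| ≤ B₁)
    (hB₂ : ∀ x, |deriv (deriv salmhoferCutoff) x| ≤ B₂) {lo s u : ℝ} (hlo : 0 < lo) (hs : lo ≤ s) (hu : s / 2 ≤ u) :
    |ppTrueKernelDu β Λ (-s) u| ≤
      (64 * (64 * B₂ + 120 * B₁ + 154) * Λ ^ 3 / (s + 2 * Λ) ^ 3 + ((β * lo) ^ 2 + 2) * Real.exp (-(β / 2 * s))) *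
        ((max (u - s) lo)⁻¹ ^ 2) := by
  have hB10 := salmhoferB₁_nonneg hB₁
  have hB20 := salmhoferB₂_nonneg hB₂
  set C : ℝ := 64 * B₂ + 120 * B₁ + 154 with hC
  have hC0 : 0 ≤ C := by rw [hC]; positivity
  have hs0 : 0 < s := hlo.trans_le hs
  have hu0 : 0 < u := by linarith
  set M : ℝ := max (u - s) lo with hM
  have hMlo : lo ≤ M := le_max_right _ _
  have hM0 : 0 < M := hlo.trans_le hMlo
  have hpow0 : 0 ≤ 64 * C * Λ ^ 3 / (s + 2 * Λ) ^ 3 := by positivity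
  have hexp0 : 0 ≤ ((β * lo) ^ 2 + 2) * Real.exp (-(β / 2 * s)) := by positivity
  rcases le_or_gt s (2 * Λ) with hsΛ | hsΛ
  · -- regime `s ≤ 2Λ`: the reflected signed envelope
    have henv := abs_ppTrueKernelDu_negLevel_le_inv_max_sq hβ hΛ hB₁ hB₂ hs0 hu
    have hMle : M ≤ max s u := max_le (by linarith [le_max_right s u]) (hs.trans (le_max_left _ _))
    have hinv : (max s u)⁻¹ ^ 2 ≤ M⁻¹ ^ 2 := pow_le_pow_left₀ (inv_nonneg.2 (hs0.le.trans (le_max_left _ _))) (inv_anti₀ hM0 hMle) 2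
    have hCle : C ≤ 64 * C * Λ ^ 3 / (s + 2 * Λ) ^ 3 := by
      rw [le_div_iff₀ (by positivity)]
      have h3 : (s + 2 * Λ) ^ 3 ≤ (4 * Λ) ^ 3 := pow_le_pow_left₀ (by positivity) (by linarith) 3
      nlinarith
    calc |ppTrueKernelDu β Λ (-s) u| ≤ C * (max s u)⁻¹ ^ 2 := henv
      _ ≤ (64 * C * Λ ^ 3 / (s + 2 * Λ) ^ 3) * M⁻¹ ^ 2 := mul_le_mul hCle hinv (by positivity) hpow0
      _ ≤ (64 * C * Λ ^ 3 / (s + 2 * Λ) ^ 3 + ((β * lo) ^ 2 + 2) * Real.exp (-(β / 2 * s))) * M⁻¹ ^ 2 := by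
          gcongr; linarith
  · -- regime `s > 2Λ`: both lines far, thermal sizes
    have hsfar : Λ < s := by linarith
    rcases le_or_gt (u - s) lo with hnear | hfar
    · -- near the diagonal: `M = lo`
      have hMeq : M = lo := max_eq_right hnear
      have hb := abs_ppTrueKernelDu_negLevel_thermal_le hβ hΛ hB₁ hsΛ hu
      rw [hMeq]
      calc |ppTrueKernelDu β Λ (-s) u| ≤ β ^ 2 * Real.exp (-(β / 2 * s)) := hb
        _ = (β * lo) ^ 2 * Real.exp (-(β / 2 * s)) * lo⁻¹ ^ 2 := by field_simp
        _ ≤ (64 * C * Λ ^ 3 / (s + 2 * Λ) ^ 3 + ((β * lo) ^ 2 + 2) * Real.exp (-(β / 2 * s))) * lo⁻¹ ^ 2 := by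
            gcongr
            nlinarith [Real.exp_pos (-(β / 2 * s))]
    · -- beyond: `M = u − s`
      have hMeq : M = u - s := max_eq_left hfar.le
      have hsu : s < u := by linarith
      have hb := abs_ppTrueKernelDu_negLevel_thermal_far_le hβ hΛ hB₁ hsfar hsu
      have hexp : Real.exp (-(β * s)) ≤ Real.exp (-(β / 2 * s)) := Real.exp_le_exp.2 (by nlinarith)
      rw [hMeq]
      calc |ppTrueKernelDu β Λ (-s) u| ≤ 2 * Real.exp (-(β * s)) * ((u - s)⁻¹ ^ 2) := hb
        _ ≤ 2 * Real.exp (-(β / 2 * s)) * ((u - s)⁻¹ ^ 2) := by gcongr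
        _ ≤ (64 * C * Λ ^ 3 / (s + 2 * Λ) ^ 3 + ((β * lo) ^ 2 + 2) * Real.exp (-(β / 2 * s))) * ((u - s)⁻¹ ^ 2) := by
            gcongr
            nlinarith [Real.exp_pos (-(β / 2 * s)), sq_nonneg (β * lo)]

/-- **ROW `hK1` in `deriv` form** (the binder shape of `abs_intervalIntegral_levelLine_diagonal_le` with `K s := fun u ↦ P(−s,u)`).
[cite: BenfattoGiulianiMastropietro2006, §2.4 (2.36)] -/
theorem abs_deriv_ppTrueKernel_negLevel_le_majorant {β Λ : ℝ} (hβ : 0 < β) (hΛ : 0 < Λ) {B₁ B₂ : ℝ} (hB₁ : ∀ x, |deriv salmhoferCutoff x| ≤ B₁)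
    (hB₂ : ∀ x, |deriv (deriv salmhoferCutoff) x| ≤ B₂) {lo hi : ℝ} (hlo : 0 < lo) :
    ∀ s ∈ Icc lo hi, ∀ u, s / 2 ≤ u → |deriv (fun v => ppTrueKernel β Λ (-s) v) u| ≤
      (64 * (64 * B₂ + 120 * B₁ + 154) * Λ ^ 3 / (s + 2 * Λ) ^ 3 + ((β * lo) ^ 2 + 2) * Real.exp (-(β / 2 * s))) *
        ((max (u - s) lo)⁻¹ ^ 2) := fun s hs u hu => by
  rw [(hasDerivAt_ppTrueKernel_u hβ hΛ hB₁ (-s) u).deriv]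
  exact abs_ppTrueKernelDu_negLevel_le_majorant hβ hΛ hB₁ hB₂ hlo hs.1 hu

/-- **ROW `hρ0`**: the majorant is nonnegative on `s ≥ 0`. [folklore] -/
theorem negPreMajorant_nonneg {β Λ B₁ B₂ lo : ℝ} (hΛ : 0 < Λ) (hB₁ : 0 ≤ B₁) (hB₂ : 0 ≤ B₂) {s : ℝ} (hs : 0 ≤ s) :
    0 ≤ 64 * (64 * B₂ + 120 * B₁ + 154) * Λ ^ 3 / (s + 2 * Λ) ^ 3 + ((β * lo) ^ 2 + 2) * Real.exp (-(β / 2 * s)) := by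
  positivity

/-- **ROW `hρi`**: the majorant is continuous on `[lo,hi]` (`lo > 0`), hence interval-integrable. [folklore] -/
theorem intervalIntegrable_negPreMajorant {β Λ B₁ B₂ lo hi : ℝ} (hΛ : 0 < Λ) (hlo : 0 < lo) (hlohi : lo ≤ hi) :
    IntervalIntegrable (fun s : ℝ => 64 * (64 * B₂ + 120 * B₁ + 154) * Λ ^ 3 / (s + 2 * Λ) ^ 3 + ((β * lo) ^ 2 + 2) * Real.exp (-(β / 2 * s)))
      volume lo hi := by
  refine ContinuousOn.intervalIntegrable ?_
  rw [uIcc_of_le hlohi]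
  refine ContinuousOn.add ?_ (by fun_prop)
  refine ContinuousOn.div (by fun_prop) (by fun_prop) fun s hs => ?_
  have : 0 < s := hlo.trans_le hs.1
  positivity

/-- **ROW `hρc`**: the majorant is continuous on `[lo,hi]` (`lo > 0`) — the binder shape of `…C4aFoldBoxPreLawBelow`. [folklore] -/
theorem continuousOn_negPreMajorant {β Λ B₁ B₂ lo hi : ℝ} (hΛ : 0 < Λ) (hlo : 0 < lo) :
    ContinuousOn (fun s : ℝ => 64 * (64 * B₂ + 120 * B₁ + 154) * Λ ^ 3 / (s + 2 * Λ) ^ 3 + ((β * lo) ^ 2 + 2) * Real.exp (-(β / 2 * s)))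
      (Icc lo hi) := by
  refine ContinuousOn.add ?_ (by fun_prop)
  refine ContinuousOn.div (by fun_prop) (by fun_prop) fun s hs => ?_
  have : 0 < s := hlo.trans_le hs.1
  positivity

/-- **`x ↦ ∂ᵤP(f x, g x)` is continuous for continuous `f, g`** — joint continuity of `(e,u) ↦ ∂ᵤP(e,u)` in composable form (a uniformly dominated series of
continuous terms; dominator `abs_ppTrueKernelDu_summand_le`). [cite: BenfattoGiulianiMastropietro2006, §2.4 (2.36)] -/
theorem continuous_ppTrueKernelDu_comp {β Λ : ℝ} (hβ : 0 < β) (hΛ : 0 < Λ) {B₁ : ℝ} (hB₁ : ∀ x, |deriv salmhoferCutoff x| ≤ B₁)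
    {X : Type*} [TopologicalSpace X] {f g : X → ℝ} (hf : Continuous f) (hg : Continuous g) :
    Continuous fun x : X => ppTrueKernelDu β Λ (f x) (g x) := by
  unfold ppTrueKernelDu
  refine continuous_const.mul ?_
  refine continuous_tsum (fun n => ?_) ((summable_one_div_ppFreq_sq_add_sq hβ 0).mul_left (8 * B₁ / Λ + 5 / 2 * (β / π))) fun n x => ?_
  · have hWe : Continuous fun x : X => uvWeightFn Λ (ppFreq β n) (f x) := (continuous_uvWeightFn_level Λ _).comp hf
    have hWu : Continuous fun x : X => uvWeightFn Λ (ppFreq β n) (g x) := (continuous_uvWeightFn_level Λ _).comp hg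
    have hW1u : Continuous fun x : X => uvWeightFnD1 Λ (ppFreq β n) (g x) := (continuous_uvWeightFnD1_level Λ _).comp hg
    have hω := ppFreq_pos hβ n
    have hne1 : ∀ x : X, (ppFreq β n ^ 2 + f x ^ 2) * (ppFreq β n ^ 2 + g x ^ 2) ≠ 0 := fun x => by positivity
    have hne2 : ∀ x : X, (ppFreq β n ^ 2 + f x ^ 2) * (ppFreq β n ^ 2 + g x ^ 2) ^ 2 ≠ 0 := fun x => by positivity
    have hA : Continuous fun x : X => (uvWeightFnD1 Λ (ppFreq β n) (g x) * (f x * g x + ppFreq β n ^ 2) + uvWeightFn Λ (ppFreq β n) (g x) * f x) /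
        ((ppFreq β n ^ 2 + f x ^ 2) * (ppFreq β n ^ 2 + g x ^ 2)) :=
      Continuous.div ((hW1u.mul (by fun_prop)).add (hWu.mul hf)) (by fun_prop) hne1
    have hB : Continuous fun x : X => uvWeightFn Λ (ppFreq β n) (g x) * (f x * g x + ppFreq β n ^ 2) * (2 * g x) /
        ((ppFreq β n ^ 2 + f x ^ 2) * (ppFreq β n ^ 2 + g x ^ 2) ^ 2) :=
      Continuous.div ((hWu.mul (by fun_prop)).mul (by fun_prop)) (by fun_prop) hne2
    exact hWe.mul (hA.sub hB)
  · rw [Real.norm_eq_abs]; exact abs_ppTrueKernelDu_summand_le hβ hΛ hB₁ (f x) (g x) n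

/-- **ROW `hKc`**: `(s,u) ↦ (K s)′ u = ∂ᵤP(−s,u)` is jointly continuous — the binder shape of `…C4aFoldBoxPreLawBelow`. [cite: BenfattoGiulianiMastropietro2006, §2.4 (2.36)] -/
theorem continuous_deriv_ppTrueKernel_negLevel₂ {β Λ : ℝ} (hβ : 0 < β) (hΛ : 0 < Λ) {B₁ : ℝ} (hB₁ : ∀ x, |deriv salmhoferCutoff x| ≤ B₁) :
    Continuous fun p : ℝ × ℝ => deriv (fun v => ppTrueKernel β Λ (-p.1) v) p.2 := by
  have hd : ∀ p : ℝ × ℝ, deriv (fun v => ppTrueKernel β Λ (-p.1) v) p.2 = ppTrueKernelDu β Λ (-p.1) p.2 :=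
    fun p => (hasDerivAt_ppTrueKernel_u hβ hΛ hB₁ (-p.1) p.2).deriv
  simp_rw [hd]
  exact continuous_ppTrueKernelDu_comp hβ hΛ hB₁ continuous_fst.neg continuous_snd

/-- The tail law for the power piece: `0 < lo ≤ a ≤ hi` ⟹ `∫_a^hi 64CΛ³/(s+2Λ)³ ds ≤ 32C(Λ/lo)³·(lo·(lo/a)²)` (primitive `−32CΛ³/(s+2Λ)²`). [folklore] -/
theorem intervalIntegral_cube_tail_le {C Λ lo a hi : ℝ} (hC : 0 ≤ C) (hΛ : 0 < Λ) (hlo : 0 < lo) (ha : lo ≤ a) (hahi : a ≤ hi) :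
    ∫ s in a..hi, 64 * C * Λ ^ 3 / (s + 2 * Λ) ^ 3 ≤ 32 * C * (Λ / lo) ^ 3 * (lo * (lo / a) ^ 2) := by
  have ha0 : 0 < a := hlo.trans_le ha
  have hderiv : ∀ s ∈ uIcc a hi, HasDerivAt (fun s : ℝ => -(32 * C * Λ ^ 3) * ((s + 2 * Λ) ^ 2)⁻¹) (64 * C * Λ ^ 3 / (s + 2 * Λ) ^ 3) s := by
    intro s hs
    rw [uIcc_of_le hahi] at hs
    have hs0 : 0 < s + 2 * Λ := by linarith [hs.1]
    have h1 : HasDerivAt (fun s : ℝ => (s + 2 * Λ) ^ 2) (2 * (s + 2 * Λ)) s := by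
      have h := ((hasDerivAt_id s).add_const (2 * Λ)).pow 2
      refine h.congr_deriv ?_
      simp
    have h2 := (h1.inv (by positivity)).const_mul (-(32 * C * Λ ^ 3))
    refine h2.congr_deriv ?_
    field_simp
    ring
  have hcont : ContinuousOn (fun s : ℝ => 64 * C * Λ ^ 3 / (s + 2 * Λ) ^ 3) (uIcc a hi) := by
    rw [uIcc_of_le hahi]
    refine ContinuousOn.div (by fun_prop) (by fun_prop) fun s hs => ?_
    have : 0 < s := ha0.trans_le hs.1
    positivity
  rw [intervalIntegral.integral_eq_sub_of_hasDerivAt hderiv hcont.intervalIntegrable]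
  have hhi0 : 0 < hi + 2 * Λ := by linarith
  have h1 : -(32 * C * Λ ^ 3) * ((hi + 2 * Λ) ^ 2)⁻¹ - -(32 * C * Λ ^ 3) * ((a + 2 * Λ) ^ 2)⁻¹ ≤ 32 * C * Λ ^ 3 * ((a + 2 * Λ) ^ 2)⁻¹ := by
    have : 0 ≤ 32 * C * Λ ^ 3 * ((hi + 2 * Λ) ^ 2)⁻¹ := by positivity
    linarith
  have h2 : ((a + 2 * Λ) ^ 2)⁻¹ ≤ (a ^ 2)⁻¹ := inv_anti₀ (by positivity) (pow_le_pow_left₀ ha0.le (by linarith) 2)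
  calc -(32 * C * Λ ^ 3) * ((hi + 2 * Λ) ^ 2)⁻¹ - -(32 * C * Λ ^ 3) * ((a + 2 * Λ) ^ 2)⁻¹
      ≤ 32 * C * Λ ^ 3 * ((a + 2 * Λ) ^ 2)⁻¹ := h1
    _ ≤ 32 * C * Λ ^ 3 * (a ^ 2)⁻¹ := mul_le_mul_of_nonneg_left h2 (by positivity)
    _ = 32 * C * (Λ / lo) ^ 3 * (lo * (lo / a) ^ 2) := by field_simp

/-- **ROW `hρtail` — THE TAIL LAW**: `0 < lo ≤ a ≤ hi` ⟹ `∫_a^hi ρ ≤ Mρ·(lo·(lo/a)²)` with `Mρ = 32·C½·(Λ/lo)³ + 32·((β·lo)²+2)/(β·lo)³`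
(power piece: `intervalIntegral_cube_tail_le`; thermal piece: k3c3-p3's `intervalIntegral_exp_tail_le` with `κ = β/2`). [folklore] -/
theorem intervalIntegral_negPreMajorant_tail_le {β Λ B₁ B₂ lo hi : ℝ} (hβ : 0 < β) (hΛ : 0 < Λ) (hB₁ : 0 ≤ B₁) (hB₂ : 0 ≤ B₂) (hlo : 0 < lo) :
    ∀ a ∈ Icc lo hi, ∫ s in a..hi, (64 * (64 * B₂ + 120 * B₁ + 154) * Λ ^ 3 / (s + 2 * Λ) ^ 3 + ((β * lo) ^ 2 + 2) * Real.exp (-(β / 2 * s))) ≤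
      (32 * (64 * B₂ + 120 * B₁ + 154) * (Λ / lo) ^ 3 + 32 * ((β * lo) ^ 2 + 2) / (β * lo) ^ 3) * (lo * (lo / a) ^ 2) := fun a ha => by
  set C : ℝ := 64 * B₂ + 120 * B₁ + 154 with hC
  have hC0 : 0 ≤ C := by rw [hC]; positivity
  have ha0 : 0 < a := hlo.trans_le ha.1
  have hcont1 : ContinuousOn (fun s : ℝ => 64 * C * Λ ^ 3 / (s + 2 * Λ) ^ 3) (uIcc a hi) := by
    rw [uIcc_of_le ha.2]
    refine ContinuousOn.div (by fun_prop) (by fun_prop) fun s hs => ?_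
    have : 0 < s := ha0.trans_le hs.1
    positivity
  have hi1 : IntervalIntegrable (fun s : ℝ => 64 * C * Λ ^ 3 / (s + 2 * Λ) ^ 3) volume a hi := hcont1.intervalIntegrable
  have hi2 : IntervalIntegrable (fun s : ℝ => ((β * lo) ^ 2 + 2) * Real.exp (-(β / 2 * s))) volume a hi :=
    (by fun_prop : Continuous fun s : ℝ => ((β * lo) ^ 2 + 2) * Real.exp (-(β / 2 * s))).intervalIntegrable _ _
  rw [intervalIntegral.integral_add hi1 hi2]
  have h1 := intervalIntegral_cube_tail_le hC0 hΛ hlo ha.1 ha.2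
  have h2 := intervalIntegral_exp_tail_le (R := (β * lo) ^ 2 + 2) (κ := β / 2) (by positivity) (by positivity) hlo ha.1 hi
  have h2' : 4 * ((β * lo) ^ 2 + 2) / (β / 2 * lo) ^ 3 = 32 * ((β * lo) ^ 2 + 2) / (β * lo) ^ 3 := by
    field_simp
    ring
  rw [h2'] at h2
  calc (∫ s in a..hi, 64 * C * Λ ^ 3 / (s + 2 * Λ) ^ 3) + ∫ s in a..hi, ((β * lo) ^ 2 + 2) * Real.exp (-(β / 2 * s))
      ≤ 32 * C * (Λ / lo) ^ 3 * (lo * (lo / a) ^ 2) + 32 * ((β * lo) ^ 2 + 2) / (β * lo) ^ 3 * (lo * (lo / a) ^ 2) := add_le_add h1 h2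
    _ = (32 * C * (Λ / lo) ^ 3 + 32 * ((β * lo) ^ 2 + 2) / (β * lo) ^ 3) * (lo * (lo / a) ^ 2) := by ring

/-- **THE PRE-CAUSTIC LEVEL LINE ALONG THE DIAGONAL FOR THE TRUE MIXED-SIGN KERNEL (ONE CALL).**  `0 < β`, `0 < Λ`, `|χ′| ≤ B₁`, `|χ″| ≤ B₂`;
levels `0 < lo ≤ hi`; diagonal level `D > 0`; weight `|X| ≤ X₀`; profile `0 ≤ w ≤ W`; partner line `ē` with `|ē s − s − D| ≤ s/2` on `[lo,hi]`; the
integrand interval-integrable.  THEN, with `K s := u ↦ P(−s,u)` (`ppTrueKernel β Λ (−s) u`) and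
`Mρ = 32·(64B₂+120B₁+154)·(Λ/lo)³ + 32·((β·lo)²+2)/(β·lo)³`:
`|∫_{lo..hi} w·X·(K s)′(ē s)| ≤ 5·(W·X₀·Mρ)·(lo/max(D,lo)²)` — k3c3-p3's `abs_intervalIntegral_levelLine_diagonal_le` with its four kernel rows
discharged by this file. [cite: BenfattoGiulianiMastropietro2006, §2.4 (2.36)] -/
theorem abs_intervalIntegral_levelLine_diagonal_ppTrueKernel_le {β Λ : ℝ} (hβ : 0 < β) (hΛ : 0 < Λ) {B₁ B₂ : ℝ}
    (hB₁ : ∀ x, |deriv salmhoferCutoff x| ≤ B₁) (hB₂ : ∀ x, |deriv (deriv salmhoferCutoff) x| ≤ B₂)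
    {w X eb : ℝ → ℝ} {lo hi D X₀ W : ℝ} (hlo : 0 < lo) (hlohi : lo ≤ hi) (hD : 0 < D)
    (hfi : IntervalIntegrable (fun s => w s * X s * deriv (fun v => ppTrueKernel β Λ (-s) v) (eb s)) volume lo hi)
    (hw0 : ∀ s ∈ Icc lo hi, 0 ≤ w s) (hwW : ∀ s ∈ Icc lo hi, w s ≤ W) (hX0 : ∀ s ∈ Icc lo hi, |X s| ≤ X₀)
    (hdev : ∀ s ∈ Icc lo hi, |eb s - s - D| ≤ s / 2) :
    |∫ s in lo..hi, w s * X s * deriv (fun v => ppTrueKernel β Λ (-s) v) (eb s)| ≤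
      5 * (W * X₀ * (32 * (64 * B₂ + 120 * B₁ + 154) * (Λ / lo) ^ 3 + 32 * ((β * lo) ^ 2 + 2) / (β * lo) ^ 3)) * (lo / (max D lo) ^ 2) := by
  have hB10 := salmhoferB₁_nonneg hB₁
  have hB20 := salmhoferB₂_nonneg hB₂
  exact abs_intervalIntegral_levelLine_diagonal_le (K := fun s v => ppTrueKernel β Λ (-s) v)
    (ρ := fun s => 64 * (64 * B₂ + 120 * B₁ + 154) * Λ ^ 3 / (s + 2 * Λ) ^ 3 + ((β * lo) ^ 2 + 2) * Real.exp (-(β / 2 * s)))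
    hlo hlohi hD (abs_deriv_ppTrueKernel_negLevel_le_majorant hβ hΛ hB₁ hB₂ hlo)
    (fun s hs => negPreMajorant_nonneg hΛ hB10 hB20 (hlo.le.trans hs.1)) (intervalIntegrable_negPreMajorant hΛ hlo hlohi)
    (intervalIntegral_negPreMajorant_tail_le hβ hΛ hB10 hB20 hlo) hfi hw0 hwW hX0 hdev

end Summit.HubbardSuperconductivity.HubbardSuperconductivity.Theorems.C4a

end
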